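import Literature.NumberTheory.Rogawski1990.KottwitzSignTwistedFrameArch
import Literature.NumberTheory.Rogawski1990.SingularObstructionSwap
import Literature.NumberTheory.Automorphic.UnitaryGroupLocalCongr
import HarnessLib

/-!
# Kottwitz signs, XII: THE LOCAL FLIP — `e_v(q_v) = e_v((γ₀)_v) · χ_v(W_v)` at every finite place and `e_w(q) = e_w(γ₀ ⊗ 1) · χ_w(W_w)` at every
# complex place (Rogawski 1990, §3.8 Prop. 3.8.1 (d) p. 37, §4.1 (4.1.2) pp. 39–40; Kottwitz 1986 §7, §9)

Topic `NumberTheory/Rogawski1990`; namespace `Literature.NumberTheory.Rogawski1990`.  THEOREMS ONLY (no definition, no named fact, no instance,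
no notation, no `sorry`).  Cell `pub/hodgecm-mathlib`, ENGINE T1 (crux H413 = `stmt-HodgeConjecture-24833`), row O7 «singular semisimple classes»,
O7 OWNER WORDS #43∕#46 row (d) «THE SIGN WEIGHT READS THE OBSTRUCTION» (FILE 1 = this trilogy `KottwitzSignTwistedFrame` ∕ `…Arch` ∕ `KottwitzSignLocalFlip`;
FILE 2 `KottwitzSignReadsObs` (A-p18) assembles the two flips with ★ `MatchingAdeleG₂.singularObs_eq_quadraticArtinIndicator` and ★
`quadraticArtinIndicator_eq_natCast_ncard`).  HC_CM is proved only modulo the printed citations until rung 0 closes; nothing printed is consumed here.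

## The statement

`H ∈ M₃(L)` hermitian non-degenerate over the CM field `L`; `γ₀ ∈ U(H)(L⁺)` rational split-singular non-central (`(γ₀ − a)(γ₀ − b) = 0`, `a ≠ b`,
`a ā = b b̄ = 1`); `q` a matching adèle over `γ₀` with adelic conjugator `g` (`g (γ₀ ⊗ 1) g⁻¹ = q`, ★ `exists_gl_conj_eq_adele_of_mul_sub_eq_zero`);
`W ∈ 𝕀_{L⁺}` the idèle descended from the block determinant of the adelic Cartan class (`W ⊗ 1 = adelicBlockDet γ₀ a b g`, ★
`exists_ideleBaseChange_eq_adelicBlockDet`), `θ = cmQuadraticGenerator L`.  Then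
* (3-fin) **`kottwitzSignLocal_toLocal_adele_eq`**: `e_v(q_v) = e_v((γ₀)_v) · χ_v(W_v)`, `χ_v(W_v) = 1` iff `W_v ∈ quadraticNormSubgroup (L⁺_v) θ`;
* (3-arch) **`kottwitzSignAt_archPart_adele_eq`**: `e_w(q_∞) = e_w(γ₀ ⊗ 1) · χ_w(W)`, `χ_w(W) = 1` iff `W_{w|L⁺} ∈ quadraticNormSubgroup (L⁺_{w|L⁺}) θ` (iff `W_{w|L⁺} > 0`).
Route: the framed readings ★ `kottwitzSignLocal_toLocal_eq_neg_one_iff_of_frame` ∕ ★ `kottwitzSignAt_archPart_eq_neg_one_iff_of_frame` at `q` and at the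
base point (`g = 1`, ★ `adelicBlockDet_one`), the norm dictionaries, and — when the frame lists the eigenvalues in the order `(b, a)` — the swap
★ `adelicBlockDet_mul_adelicBlockDet_swap` (the two block determinants differ by the norm `σ(det g) · det g`).  With ★ `quadraticArtinIndicator_eq_natCast_ncard`
and ★ `MatchingAdeleG₂.singularObs_eq_quadraticArtinIndicator` these give `e_𝐀(q) = (−1)^{obs(q)}` (FILE 2).

## References
* [Rogawski1990] J. D. Rogawski, *Automorphic Representations of Unitary Groups in Three Variables*, Ann. of Math. Stud. 123 (1990), §3.3 (3.3.1) p. 22;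
  §3.8 Prop. 3.8.1 (a)(d) p. 37; §4.1 (4.1.2) pp. 39–40; §8.2 p. 117.
* [Kottwitz1983] R. E. Kottwitz, *Sign changes in harmonic analysis on reductive groups*, Trans. AMS 278 (1983), 289–297.
* [Kottwitz1986] R. E. Kottwitz, *Stable trace formula: elliptic singular terms*, Math. Ann. 275 (1986), §7 Prop. 7.1, §9.
* [Omeara1963] O. T. O'Meara, *Introduction to Quadratic Forms* (1963), §63B, §65A Example 65:2.
* [CasselsFrohlichANT1967] Cassels–Fröhlich (eds.), *Algebraic Number Theory* (1967), Ch. II §10, Ch. VII Prop. 1.2.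
-/

set_option autoImplicit false

noncomputable section

open NumberField NumberField.InfinitePlace IsDedekindDomain Matrix
open scoped MatrixGroups

namespace Literature.NumberTheory.Rogawski1990

open Literature.NumberTheory.Automorphic Literature.NumberTheory.Automorphic.UnitaryGroup
open Literature.NumberTheory.GaloisRepresentations Literature.NumberTheory.QuadraticForms
open Literature.AlgebraicGeometry.ShimuraVarieties (unitaryGroup hermForm)

section LettersFlip

variable {L : Type} [Field L] [NumberField L] [IsCMField L]

/-- `πᵥ` intertwines `σ_𝔸` with `σᵥ`. [folklore] -/
private theorem adeleToLocal_adeleConj₆ (v : HeightOneSpectrum (𝓞 ↥(maximalRealSubfield L))) (x : AdeleRing (𝓞 L) L) :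
    UnitaryGroup.adeleToLocal L v (adeleConj L x) = UnitaryGroup.conjLocal L (IsCMField.complexConj L) v (UnitaryGroup.adeleToLocal L v x) := by
  rw [← UnitaryGroup.conjAdele_complexConj]
  exact UnitaryGroup.adeleToLocal_conj L (IsCMField.complexConj L) v x

/-- `cmConjRingHom` is an involution. [folklore] -/
private theorem cmConjRingHom_cmConjRingHom₆ (x : L) : cmConjRingHom L (cmConjRingHom L x) = x := by
  rw [cmConjRingHom_apply, cmConjRingHom_apply, IsCMField.complexConj_apply_apply]

end LettersFlip

/-! ## §3 The finite flip `e_v(q_v) = e_v((γ₀)_v) · χ_v(W_v)` -/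

section FiniteFlip

variable {L : Type} [Field L] [NumberField L] [IsCMField L] {H : Matrix (Fin 3) (Fin 3) L} {γ₀ : (UnitaryGroup.cmDatum L 3 H).Rational}

/-- Bookkeeping of `±1`: if `e = −1 ↔ ¬(A ↔ B)` and `e₀ = −1 ↔ ¬A` then `e = e₀ · χ_B`, `χ_B = 1` iff `B`. [folklore] -/
private theorem units_eq_mul_ite {e e₀ : ℤˣ} (he : e = 1 ∨ e = -1) (he₀ : e₀ = 1 ∨ e₀ = -1) {A B : Prop} [Decidable B]
    (h : e = -1 ↔ ¬ (A ↔ B)) (h₀ : e₀ = -1 ↔ ¬ A) : e = e₀ * (if B then 1 else -1) := by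
  by_cases hA : A <;> by_cases hB : B <;> rcases he with he | he <;> rcases he₀ with he₀ | he₀ <;> simp_all

omit [IsCMField L] in
/-- The `v`-component of a principal adèle of `L` coming from `L⁺`: `πᵥ (r ⊗ 1) = ι_v (r)` for `r ∈ L⁺`. [folklore] -/
private theorem adeleToLocal_algebraMap_of_real (v : HeightOneSpectrum (𝓞 ↥(maximalRealSubfield L))) (r : ↥(maximalRealSubfield L)) :
    UnitaryGroup.adeleToLocal L v (algebraMap L (AdeleRing (𝓞 L) L) (r : L)) =
      UnitaryGroup.toLocalRing L v ((r : v.adicCompletion ↥(maximalRealSubfield L))) := by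
  rw [UnitaryGroup.toLocalRing_coe, ← UnitaryGroup.adeleToLocal_comp_algebraMap (E := L) v, RingHom.comp_apply]
  rfl

open scoped Classical in
/-- **THE FINITE FLIP in frame order** — for the eigenvalue pair `(a, b)` of a diagonal frame (`a` the PLANE eigenvalue) and the idèle `W` descended
from `adelicBlockDet γ₀ a b g`: `e_v(q_v) = e_v((γ₀)_v) · χ_v(W_v)`. [cite: Rogawski1990, §3.8 Prop. 3.8.1 (d) p. 37; §4.1 (4.1.2) pp. 39–40]
[cite: Kottwitz1986, §9] -/
theorem kottwitzSignLocal_toLocal_adele_eq_of_frame (hH : (H.map (cmConjRingHom L))ᵀ = H) (hHd : H.det ≠ 0) {a b : L} (hab : a ≠ b)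
    (hγ₀ : ((((γ₀ : unitaryGroup (cmConjRingHom L) H).val : GL (Fin 3) L) : Matrix (Fin 3) (Fin 3) L) - a • (1 : Matrix (Fin 3) (Fin 3) L)) *
      ((((γ₀ : unitaryGroup (cmConjRingHom L) H).val : GL (Fin 3) L) : Matrix (Fin 3) (Fin 3) L) - b • (1 : Matrix (Fin 3) (Fin 3) L)) = 0)
    {P : GL (Fin 3) L} {d : Fin 3 → L} (hd : ∀ i, cmConjRingHom L (d i) = d i) (hd0 : ∀ i, d i ≠ 0)
    (hP : (((P : Matrix (Fin 3) (Fin 3) L)).map (cmConjRingHom L))ᵀ * H * (P : Matrix (Fin 3) (Fin 3) L) = Matrix.diagonal d)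
    (hγP : (((γ₀ : unitaryGroup (cmConjRingHom L) H).val : GL (Fin 3) L).val : Matrix (Fin 3) (Fin 3) L) * (P : Matrix (Fin 3) (Fin 3) L) =
      (P : Matrix (Fin 3) (Fin 3) L) * finSum 2 1 (a • (1 : Matrix (Fin 2) (Fin 2) L)) (b • (1 : Matrix (Fin 1) (Fin 1) L)))
    (q : MatchingAdeleG₂ L H H γ₀) {g : GL (Fin 3) (AdeleRing (𝓞 L) L)}
    (hg : g * (((UnitaryGroup.cmDatum L 3 H).toAdelic γ₀).val : GL (Fin 3) (AdeleRing (𝓞 L) L)) * g⁻¹ = (q.adele.val : GL (Fin 3) (AdeleRing (𝓞 L) L)))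
    (W : (AdeleRing (𝓞 ↥(maximalRealSubfield L)) ↥(maximalRealSubfield L))ˣ)
    (hW : ((AdeleRing.ideleBaseChange (↥(maximalRealSubfield L)) L W : (AdeleRing (𝓞 L) L)ˣ) : AdeleRing (𝓞 L) L) = adelicBlockDet γ₀ a b g)
    (v : HeightOneSpectrum (𝓞 ↥(maximalRealSubfield L))) :
    kottwitzSignLocal L 3 H v (ConjClasses.mk ((UnitaryGroup.cmDatum L 3 H).toLocal v q.adele)) =
      kottwitzSignLocal L 3 H v (ConjClasses.mk ((UnitaryGroup.cmDatum L 3 H).toLocal v ((UnitaryGroup.cmDatum L 3 H).toAdelic γ₀))) *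
        (if ideleFiniteComponent (↥(maximalRealSubfield L)) v W ∈
            quadraticNormSubgroup (v.adicCompletion ↥(maximalRealSubfield L))
              (algebraMap (↥(maximalRealSubfield L)) (v.adicCompletion ↥(maximalRealSubfield L)) (cmQuadraticGenerator L : ↥(maximalRealSubfield L)))
          then 1 else -1) := by
  set Kv := v.adicCompletion ↥(maximalRealSubfield L) with hKv
  set N := quadraticNormSubgroup Kv (algebraMap (↥(maximalRealSubfield L)) Kv (cmQuadraticGenerator L : ↥(maximalRealSubfield L))) with hN
  set tW : Kvˣ := ideleFiniteComponent (↥(maximalRealSubfield L)) v W with htW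
  have hHu : IsUnit H.det := isUnit_iff_ne_zero.mpr hHd
  have he : kottwitzSignLocal L 3 H v (ConjClasses.mk ((UnitaryGroup.cmDatum L 3 H).toLocal v q.adele)) = 1 ∨
      kottwitzSignLocal L 3 H v (ConjClasses.mk ((UnitaryGroup.cmDatum L 3 H).toLocal v q.adele)) = -1 := by
    unfold kottwitzSignLocal; exact kottwitzSign_eq_one_or_eq_neg_one _
  have he₀ : kottwitzSignLocal L 3 H v (ConjClasses.mk ((UnitaryGroup.cmDatum L 3 H).toLocal v ((UnitaryGroup.cmDatum L 3 H).toAdelic γ₀))) = 1 ∨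
      kottwitzSignLocal L 3 H v (ConjClasses.mk ((UnitaryGroup.cmDatum L 3 H).toLocal v ((UnitaryGroup.cmDatum L 3 H).toAdelic γ₀))) = -1 := by
    unfold kottwitzSignLocal; exact kottwitzSign_eq_one_or_eq_neg_one _
  by_cases hsplit : ∃ w : UnitaryGroup.PlacesOver L v, IsCMField.complexConj L • w.1 ≠ w.1
  · -- SPLIT place: all three factors are `1`
    obtain ⟨w, hw⟩ := hsplit
    rw [kottwitzSignLocal_eq_one_of_smul_ne L 3 H v w hw, kottwitzSignLocal_eq_one_of_smul_ne L 3 H v w hw,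
      if_pos (mem_quadraticNormSubgroup_of_smul_ne v w hw tW), mul_one]
  · -- NON-SPLIT place
    push Not at hsplit
    obtain ⟨w⟩ : Nonempty (UnitaryGroup.PlacesOver L v) := inferInstance
    have hw := hsplit w
    -- the plane's determinant `d₀ d₁ ∈ L⁺`
    have hdc : ∀ i, IsCMField.complexConj L (d i) = d i := fun i => by rw [← cmConjRingHom_apply]; exact hd i
    set r : ↥(maximalRealSubfield L) := ⟨d 0 * d 1, (IsCMField.complexConj_eq_self_iff (K := L) _).1 (by rw [map_mul, hdc, hdc])⟩ with hr
    have hr0 : (r : Kv) ≠ 0 := by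
      have : (r : ↥(maximalRealSubfield L)) ≠ 0 := fun h => mul_ne_zero (hd0 0) (hd0 1) (congrArg Subtype.val h)
      exact (map_ne_zero (algebraMap (↥(maximalRealSubfield L)) Kv)).2 this
    set t₀ : Kvˣ := Units.mk0 (r : Kv) hr0 with ht₀
    -- the two framed readings: at `q` and at the base point
    have hread := kottwitzSignLocal_toLocal_eq_neg_one_iff_of_frame (γ₀ := γ₀) hH hHd hab hP hγP q hg v w hw
    have hg₁ : (1 : GL (Fin 3) (AdeleRing (𝓞 L) L)) * (((UnitaryGroup.cmDatum L 3 H).toAdelic γ₀).val : GL (Fin 3) (AdeleRing (𝓞 L) L)) * 1⁻¹ =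
        ((MatchingAdeleG₂.self γ₀).adele.val : GL (Fin 3) (AdeleRing (𝓞 L) L)) := by
      rw [one_mul, inv_one, mul_one, MatchingAdeleG₂.adele_self]
    have hread₀ := kottwitzSignLocal_toLocal_eq_neg_one_iff_of_frame (γ₀ := γ₀) hH hHd hab hP hγP (MatchingAdeleG₂.self γ₀) hg₁ v w hw
    rw [MatchingAdeleG₂.adele_self, adelicBlockDet_one hHu hab hγ₀, mul_one] at hread₀
    -- read the two right-hand sides in `L⁺_vˣ`
    have hπr : UnitaryGroup.adeleToLocal L v (algebraMap L (AdeleRing (𝓞 L) L) (d 0 * d 1)) = UnitaryGroup.toLocalRing L v (t₀ : Kv) := by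
      rw [ht₀, Units.val_mk0, show d 0 * d 1 = ((r : ↥(maximalRealSubfield L)) : L) from rfl, adeleToLocal_algebraMap_of_real]
    have hπW : UnitaryGroup.adeleToLocal L v (adelicBlockDet γ₀ a b g) = UnitaryGroup.toLocalRing L v (tW : Kv) := by
      rw [← hW, adeleToLocal_ideleBaseChange, htW, val_ideleFiniteComponent]
    have hrhs : -(UnitaryGroup.adeleToLocal L v (algebraMap L (AdeleRing (𝓞 L) L) (d 0 * d 1) * adelicBlockDet γ₀ a b g)) =
        UnitaryGroup.toLocalRing L v ((-(t₀ * tW) : Kvˣ) : Kv) := by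
      rw [map_mul, hπr, hπW, ← map_mul, ← map_neg, Units.val_neg, Units.val_mul]
    have hrhs₀ : -(UnitaryGroup.adeleToLocal L v (algebraMap L (AdeleRing (𝓞 L) L) (d 0 * d 1))) = UnitaryGroup.toLocalRing L v ((-t₀ : Kvˣ) : Kv) := by
      rw [hπr, ← map_neg, Units.val_neg]
    rw [hrhs, exists_mul_conjLocal_eq_toLocalRing_iff, neg_mul_eq_neg_mul, mul_mem_quadraticNormSubgroup_iff] at hread
    rw [hrhs₀, exists_mul_conjLocal_eq_toLocalRing_iff] at hread₀
    exact units_eq_mul_ite he he₀ hread hread₀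

open scoped Classical in
/-- **(3-fin) THE FINITE FLIP `e_v(q_v) = e_v((γ₀)_v) · χ_v(W_v)`.**  `H ∈ M₃(L)` hermitian non-degenerate over the CM field `L`; `γ₀ ∈ U(H)(L⁺)` rational,
split-singular (`(γ₀ − a)(γ₀ − b) = 0`, `a ≠ b`, `a ā = b b̄ = 1`) and non-central; `q` a matching adèle over `γ₀` with adelic conjugator `g`
(`g (γ₀ ⊗ 1) g⁻¹ = q`); `W ∈ 𝕀_{L⁺}` with `W ⊗ 1 = adelicBlockDet γ₀ a b g` (★ `exists_ideleBaseChange_eq_adelicBlockDet`).  Then at every finite place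
`v` of `L⁺` the local Kottwitz sign of `q_v` is that of `(γ₀)_v` times `χ_v(W_v)`, where `χ_v(W_v) = 1` iff `W_v ∈ quadraticNormSubgroup (L⁺_v) θ`
(`θ = cmQuadraticGenerator L`), i.e. iff the Hilbert symbol `(W_v, θ)_v` is `1`.  At a split `v` all three are `1`; at a non-split `v` this is the framed
reading §2 for `q` and for the base point, through the local norm dictionary §1 (the two frame orders agree by ★ `adelicBlockDet_mul_adelicBlockDet_swap`:
the two block determinants differ by the norm `σ(det g) det g`). [cite: Rogawski1990, §3.8 Prop. 3.8.1 (a)(d) p. 37; §4.1 (4.1.2) pp. 39–40; §3.3 (3.3.1) p. 22]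
[cite: Kottwitz1986, §7 Prop. 7.1, §9] [cite: Omeara1963, §63B] -/
theorem kottwitzSignLocal_toLocal_adele_eq (hH : (H.map (cmConjRingHom L))ᵀ = H) (hdet : H.det ≠ 0)
    {a b : L} (hab : a ≠ b) (ha : a * cmConjRingHom L a = 1) (hb : b * cmConjRingHom L b = 1)
    (hγ₀ : ((((γ₀ : unitaryGroup (cmConjRingHom L) H).val : GL (Fin 3) L) : Matrix (Fin 3) (Fin 3) L) - a • (1 : Matrix (Fin 3) (Fin 3) L)) *
      ((((γ₀ : unitaryGroup (cmConjRingHom L) H).val : GL (Fin 3) L) : Matrix (Fin 3) (Fin 3) L) - b • (1 : Matrix (Fin 3) (Fin 3) L)) = 0)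
    (hα : (((γ₀ : unitaryGroup (cmConjRingHom L) H).val : GL (Fin 3) L) : Matrix (Fin 3) (Fin 3) L) ≠ a • 1)
    (hβ : (((γ₀ : unitaryGroup (cmConjRingHom L) H).val : GL (Fin 3) L) : Matrix (Fin 3) (Fin 3) L) ≠ b • 1)
    (q : MatchingAdeleG₂ L H H γ₀) {g : GL (Fin 3) (AdeleRing (𝓞 L) L)}
    (hg : g * (((UnitaryGroup.cmDatum L 3 H).toAdelic γ₀).val : GL (Fin 3) (AdeleRing (𝓞 L) L)) * g⁻¹ = (q.adele.val : GL (Fin 3) (AdeleRing (𝓞 L) L)))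
    (W : (AdeleRing (𝓞 ↥(maximalRealSubfield L)) ↥(maximalRealSubfield L))ˣ)
    (hW : ((AdeleRing.ideleBaseChange (↥(maximalRealSubfield L)) L W : (AdeleRing (𝓞 L) L)ˣ) : AdeleRing (𝓞 L) L) = adelicBlockDet γ₀ a b g)
    (v : HeightOneSpectrum (𝓞 ↥(maximalRealSubfield L))) :
    kottwitzSignLocal L 3 H v (ConjClasses.mk ((UnitaryGroup.cmDatum L 3 H).toLocal v q.adele)) =
      kottwitzSignLocal L 3 H v (ConjClasses.mk ((UnitaryGroup.cmDatum L 3 H).toLocal v ((UnitaryGroup.cmDatum L 3 H).toAdelic γ₀))) *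
        (if ideleFiniteComponent (↥(maximalRealSubfield L)) v W ∈
            quadraticNormSubgroup (v.adicCompletion ↥(maximalRealSubfield L))
              (algebraMap (↥(maximalRealSubfield L)) (v.adicCompletion ↥(maximalRealSubfield L)) (cmQuadraticGenerator L : ↥(maximalRealSubfield L)))
          then 1 else -1) := by
  have hHu : IsUnit H.det := isUnit_iff_ne_zero.mpr hdet
  have h2 : (1 : L) + 1 ≠ 0 := by norm_num
  obtain ⟨a', b', P, d, hab', -, -, hd, hd0, hP, hγP⟩ :=
    exists_diagonal_frame (cmConjRingHom L) (cmConjRingHom_cmConjRingHom₆ (L := L)) h2 H hH hdet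
      (γ₀ : unitaryGroup (cmConjRingHom L) H) hab hγ₀ hα hβ
  rcases hab' with ⟨rfl, rfl⟩ | ⟨rfl, rfl⟩
  · -- the frame's plane eigenvalue is `a`: `W` is the frame-order idèle
    exact kottwitzSignLocal_toLocal_adele_eq_of_frame hH hdet hab hγ₀ hd hd0 hP hγP q hg W hW v
  · -- the frame's plane eigenvalue is `b`: go through the idèle of `adelicBlockDet γ₀ b a g`
    have hγ₀' : ((((γ₀ : unitaryGroup (cmConjRingHom L) H).val : GL (Fin 3) L) : Matrix (Fin 3) (Fin 3) L) - a' • (1 : Matrix (Fin 3) (Fin 3) L)) *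
        ((((γ₀ : unitaryGroup (cmConjRingHom L) H).val : GL (Fin 3) L) : Matrix (Fin 3) (Fin 3) L) - b' • (1 : Matrix (Fin 3) (Fin 3) L)) = 0 :=
      mul_sub_swap_eq_zero hγ₀
    obtain ⟨W', hW'⟩ := exists_ideleBaseChange_eq_adelicBlockDet hH hHu hab.symm hb ha hγ₀' q hg
    rw [kottwitzSignLocal_toLocal_adele_eq_of_frame hH hdet hab.symm hγ₀' hd hd0 hP hγP q hg W' hW' v]
    congr 1
    -- `χ_v(W'_v) = χ_v(W_v)`: `W ⊗ 1 · W' ⊗ 1 = σ(det g) det g` (★ swap), so at `v` the product `W_v W'_v` is a local norm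
    have hprod : UnitaryGroup.toLocalRing L v ((ideleFiniteComponent (↥(maximalRealSubfield L)) v W *
        ideleFiniteComponent (↥(maximalRealSubfield L)) v W' : (v.adicCompletion ↥(maximalRealSubfield L))ˣ) : v.adicCompletion ↥(maximalRealSubfield L)) =
        UnitaryGroup.adeleToLocal L v (g : Matrix (Fin 3) (Fin 3) (AdeleRing (𝓞 L) L)).det *
          UnitaryGroup.conjLocal L (IsCMField.complexConj L) v (UnitaryGroup.adeleToLocal L v (g : Matrix (Fin 3) (Fin 3) (AdeleRing (𝓞 L) L)).det) := by
      rw [Units.val_mul, map_mul, val_ideleFiniteComponent, val_ideleFiniteComponent, ← adeleToLocal_ideleBaseChange, ← adeleToLocal_ideleBaseChange,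
        hW, hW', ← map_mul, adelicBlockDet_mul_adelicBlockDet_swap hHu hab hγ₀ q hg, map_mul, adeleToLocal_adeleConj₆, mul_comm]
    have hmem : ideleFiniteComponent (↥(maximalRealSubfield L)) v W * ideleFiniteComponent (↥(maximalRealSubfield L)) v W' ∈
        quadraticNormSubgroup (v.adicCompletion ↥(maximalRealSubfield L))
          (algebraMap (↥(maximalRealSubfield L)) (v.adicCompletion ↥(maximalRealSubfield L)) (cmQuadraticGenerator L : ↥(maximalRealSubfield L))) :=
      (exists_mul_conjLocal_eq_toLocalRing_iff v _).1 ⟨_, hprod.symm⟩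
    rw [mul_mem_quadraticNormSubgroup_iff] at hmem
    simp only [hmem]

end FiniteFlip
/-! ## §4 The archimedean flip -/

section ArchFlip

variable {L : Type} [Field L] [NumberField L] [IsCMField L] {H : Matrix (Fin 3) (Fin 3) L} {γ₀ : (UnitaryGroup.cmDatum L 3 H).Rational}

/-- Bookkeeping of `±1`: if `e = −1 ↔ (A ↔ B)` and `e₀ = −1 ↔ A` then `e = e₀ · χ_B`, `χ_B = 1` iff `B`. [folklore] -/
private theorem units_eq_mul_ite' {e e₀ : ℤˣ} (he : e = 1 ∨ e = -1) (he₀ : e₀ = 1 ∨ e₀ = -1) {A B : Prop} [Decidable B]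
    (h : e = -1 ↔ (A ↔ B)) (h₀ : e₀ = -1 ↔ A) : e = e₀ * (if B then 1 else -1) := by
  by_cases hA : A <;> by_cases hB : B <;> rcases he with he | he <;> rcases he₀ with he₀ | he₀ <;> simp_all

/-- `z z̄` ranges over the non-negative reals: `(∃ z ∈ ℂ, z · conj z = x) ↔ 0 ≤ x` for real `x`. [folklore] -/
private theorem exists_mul_conj_eq_ofReal_iff (x : ℝ) : (∃ z : ℂ, z * starRingEnd ℂ z = (x : ℂ)) ↔ 0 ≤ x := by
  constructor
  · rintro ⟨z, hz⟩
    rw [Complex.mul_conj] at hz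
    have h := congrArg Complex.re hz
    rw [Complex.ofReal_re, Complex.ofReal_re] at h
    rw [← h]
    exact Complex.normSq_nonneg z
  · intro hx
    refine ⟨(Real.sqrt x : ℂ), ?_⟩
    rw [Complex.conj_ofReal, ← Complex.ofReal_mul, Real.mul_self_sqrt hx]

/-- Sign of a product of non-zero reals: `0 < x y ↔ (0 < x ↔ 0 < y)`. [folklore] -/
private theorem mul_pos_iff_iff {x y : ℝ} (hx : x ≠ 0) (hy : y ≠ 0) : 0 < x * y ↔ (0 < x ↔ 0 < y) := by
  rcases lt_or_gt_of_ne hx with hx | hx <;> rcases lt_or_gt_of_ne hy with hy | hy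
  · exact ⟨fun _ => ⟨fun h => absurd h (not_lt.2 hx.le), fun h => absurd h (not_lt.2 hy.le)⟩, fun _ => mul_pos_of_neg_of_neg hx hy⟩
  · exact ⟨fun h => absurd h (not_lt.2 (mul_nonpos_iff.2 (Or.inr ⟨hx.le, hy.le⟩))), fun h => absurd (h.2 hy) (not_lt.2 hx.le)⟩
  · exact ⟨fun h => absurd h (not_lt.2 (mul_nonpos_iff.2 (Or.inl ⟨hx.le, hy.le⟩))), fun h => absurd (h.1 hx) (not_lt.2 hy.le)⟩
  · exact ⟨fun _ => ⟨fun _ => hy, fun _ => hx⟩, fun _ => mul_pos hx hy⟩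

open scoped Classical in
/-- **THE ARCHIMEDEAN FLIP in frame order** (`a` the PLANE eigenvalue of the frame, `W ⊗ 1 = adelicBlockDet γ₀ a b g`).
[cite: Rogawski1990, §4.1 (4.1.2) pp. 39–40; §8.2 p. 117] [cite: Kottwitz1986, §9] -/
theorem kottwitzSignAt_archPart_adele_eq_of_frame (hH : (H.map (cmConjRingHom L))ᵀ = H) (hHd : H.det ≠ 0) {a b : L} (hab : a ≠ b)
    (hγ₀ : ((((γ₀ : unitaryGroup (cmConjRingHom L) H).val : GL (Fin 3) L) : Matrix (Fin 3) (Fin 3) L) - a • (1 : Matrix (Fin 3) (Fin 3) L)) *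
      ((((γ₀ : unitaryGroup (cmConjRingHom L) H).val : GL (Fin 3) L) : Matrix (Fin 3) (Fin 3) L) - b • (1 : Matrix (Fin 3) (Fin 3) L)) = 0)
    {P : GL (Fin 3) L} {d : Fin 3 → L} (hd : ∀ i, cmConjRingHom L (d i) = d i) (hd0 : ∀ i, d i ≠ 0)
    (hP : (((P : Matrix (Fin 3) (Fin 3) L)).map (cmConjRingHom L))ᵀ * H * (P : Matrix (Fin 3) (Fin 3) L) = Matrix.diagonal d)
    (hγP : (((γ₀ : unitaryGroup (cmConjRingHom L) H).val : GL (Fin 3) L).val : Matrix (Fin 3) (Fin 3) L) * (P : Matrix (Fin 3) (Fin 3) L) =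
      (P : Matrix (Fin 3) (Fin 3) L) * finSum 2 1 (a • (1 : Matrix (Fin 2) (Fin 2) L)) (b • (1 : Matrix (Fin 1) (Fin 1) L)))
    (q : MatchingAdeleG₂ L H H γ₀) {g : GL (Fin 3) (AdeleRing (𝓞 L) L)}
    (hg : g * (((UnitaryGroup.cmDatum L 3 H).toAdelic γ₀).val : GL (Fin 3) (AdeleRing (𝓞 L) L)) * g⁻¹ = (q.adele.val : GL (Fin 3) (AdeleRing (𝓞 L) L)))
    (W : (AdeleRing (𝓞 ↥(maximalRealSubfield L)) ↥(maximalRealSubfield L))ˣ)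
    (hW : ((AdeleRing.ideleBaseChange (↥(maximalRealSubfield L)) L W : (AdeleRing (𝓞 L) L)ˣ) : AdeleRing (𝓞 L) L) = adelicBlockDet γ₀ a b g)
    (w : {w : InfinitePlace L // IsComplex w}) :
    kottwitzSignAt L 3 H w (UnitaryGroup.archPart (↥(maximalRealSubfield L)) L (IsCMField.complexConj L) 3 H q.adele) =
      kottwitzSignAt L 3 H w (cmRationalToArch L 3 H γ₀) *
        (if ideleInfiniteComponent (↥(maximalRealSubfield L)) (w.1.comap (algebraMap (↥(maximalRealSubfield L)) L)) W ∈
            quadraticNormSubgroup ((w.1.comap (algebraMap (↥(maximalRealSubfield L)) L)).Completion)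
              (algebraMap (↥(maximalRealSubfield L)) _ (cmQuadraticGenerator L : ↥(maximalRealSubfield L)))
          then 1 else -1) := by
  set 𝔸 := AdeleRing (𝓞 L) L with h𝔸
  set φ : 𝔸 →+* ℂ := (UnitaryGroup.evalC L w).comp ((InfiniteAdeleRing.ringEquiv_mixedSpace L).toRingHom.comp (UnitaryGroup.adeleFst L)) with hφdef
  set w₀ := w.1.comap (algebraMap (↥(maximalRealSubfield L)) L) with hw₀
  have hw₀r : w₀.IsReal := IsTotallyReal.isReal w₀
  set E := InfinitePlace.Completion.ringEquivRealOfIsReal hw₀r with hE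
  set tW : (w₀.Completion)ˣ := ideleInfiniteComponent (↥(maximalRealSubfield L)) w₀ W with htW
  set ρW : ℝ := E (tW : w₀.Completion) with hρW
  have hHu : IsUnit H.det := isUnit_iff_ne_zero.mpr hHd
  -- the three `±1`'s
  have he : kottwitzSignAt L 3 H w (UnitaryGroup.archPart (↥(maximalRealSubfield L)) L (IsCMField.complexConj L) 3 H q.adele) = 1 ∨
      kottwitzSignAt L 3 H w (UnitaryGroup.archPart (↥(maximalRealSubfield L)) L (IsCMField.complexConj L) 3 H q.adele) = -1 := by
    unfold kottwitzSignAt; exact kottwitzSign_eq_one_or_eq_neg_one _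
  have he₀ : kottwitzSignAt L 3 H w (cmRationalToArch L 3 H γ₀) = 1 ∨ kottwitzSignAt L 3 H w (cmRationalToArch L 3 H γ₀) = -1 := by
    unfold kottwitzSignAt; exact kottwitzSign_eq_one_or_eq_neg_one _
  -- the readings at `q` and at the base point
  have hread := kottwitzSignAt_archPart_eq_neg_one_iff_of_frame (γ₀ := γ₀) hH hHd hab hP hγP q hg w
  have hg₁ : (1 : GL (Fin 3) 𝔸) * (((UnitaryGroup.cmDatum L 3 H).toAdelic γ₀).val : GL (Fin 3) 𝔸) * 1⁻¹ =
      ((MatchingAdeleG₂.self γ₀).adele.val : GL (Fin 3) 𝔸) := by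
    rw [one_mul, inv_one, mul_one, MatchingAdeleG₂.adele_self]
  have hread₀ := kottwitzSignAt_archPart_eq_neg_one_iff_of_frame (γ₀ := γ₀) hH hHd hab hP hγP (MatchingAdeleG₂.self γ₀) hg₁ w
  rw [MatchingAdeleG₂.adele_self, archPart_cmDatum_toAdelic, adelicBlockDet_one hHu hab hγ₀, mul_one] at hread₀
  -- the REAL numbers `ρ₀ = w(d₀d₁)` and `ρW = W_{w₀}`
  have hφalg : ∀ r : L, φ (algebraMap L 𝔸 r) = w.1.embedding r := fun r => by
    show UnitaryGroup.evalC L w (InfiniteAdeleRing.ringEquiv_mixedSpace L (UnitaryGroup.adeleFst L (algebraMap L 𝔸 r))) = _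
    rw [show UnitaryGroup.adeleFst L (algebraMap L 𝔸 r) = (algebraMap L 𝔸 r).1 from rfl, QuadraticForms.ringEquiv_mixedSpace_fst_algebraMap,
      UnitaryGroup.evalC_apply, NumberField.mixedEmbedding.mixedEmbedding_apply_isComplex]
  set ρ₀ : ℝ := (w.1.embedding (d 0 * d 1)).re with hρ₀
  have hd01 : cmConjRingHom L (d 0 * d 1) = d 0 * d 1 := by rw [map_mul, hd, hd]
  have hρ₀c : w.1.embedding (d 0 * d 1) = (ρ₀ : ℂ) := by
    apply Complex.ext
    · rw [Complex.ofReal_re]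
    · have h := IsCMField.complexEmbedding_complexConj L w.1.embedding (d 0 * d 1)
      rw [← cmConjRingHom_apply, hd01] at h
      have him := congrArg Complex.im h
      rw [Complex.conj_im] at him
      rw [Complex.ofReal_im]; linarith
  have hρ₀0 : ρ₀ ≠ 0 := by
    intro h0
    have : w.1.embedding (d 0 * d 1) = 0 := by rw [hρ₀c, h0, Complex.ofReal_zero]
    exact mul_ne_zero (hd0 0) (hd0 1) ((map_eq_zero_iff _ w.1.embedding.injective).1 this)
  have hρWc : φ (adelicBlockDet γ₀ a b g) = (ρW : ℂ) := by
    rw [← hW, hφdef, evalC_ringEquiv_mixedSpace_ideleBaseChange]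
  have hρW0 : ρW ≠ 0 := (map_ne_zero_iff _ E.injective).2 tW.ne_zero
  -- read the two right-hand sides in `ℝ`
  have hrhs : -(φ (algebraMap L 𝔸 (d 0 * d 1) * adelicBlockDet γ₀ a b g)) = ((-(ρ₀ * ρW) : ℝ) : ℂ) := by
    rw [map_mul, hφalg, hρ₀c, hρWc, ← Complex.ofReal_mul, ← Complex.ofReal_neg]
  have hrhs₀ : -(φ (algebraMap L 𝔸 (d 0 * d 1))) = ((-ρ₀ : ℝ) : ℂ) := by
    rw [hφalg, hρ₀c, ← Complex.ofReal_neg]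
  rw [hrhs, exists_mul_conj_eq_ofReal_iff, neg_nonneg, not_le, mul_pos_iff_iff hρ₀0 hρW0] at hread
  rw [hrhs₀, exists_mul_conj_eq_ofReal_iff, neg_nonneg, not_le] at hread₀
  rw [mem_quadraticNormSubgroup_completion_iff_pos hw₀r]
  exact units_eq_mul_ite' he he₀ hread hread₀

open scoped Classical in
/-- **(3-arch) THE ARCHIMEDEAN FLIP `e_w(q) = e_w(γ₀ ⊗ 1) · χ_w(W_w)`** at a complex place `w` of `L` over the real place `w₀ = w|_{L⁺}`: with the data
of (3-fin), the `w`-coordinate Kottwitz sign of `q_∞` is that of `γ₀ ⊗ 1` times `χ_w(W) = 1` iff `W_{w₀} ∈ quadraticNormSubgroup (L⁺_{w₀}) θ`, i.e.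
iff `W_{w₀} > 0` (`θ < 0` at `w₀`).  Route: the framed reading §4 at `q` and at the base point over `ℂ`; `−det` of the twisted plane block is the real
number `−w(d₀d₁) · W_{w₀}` (★ `extensionEmbedding_ideleBaseChange_fst_apply`) and `z z̄ ≥ 0`; frame-order swap as in (3-fin).
[cite: Rogawski1990, §4.1 (4.1.2) pp. 39–40; §8.2 p. 117; §3.8 Prop. 3.8.1 (d) p. 37] [cite: Kottwitz1986, §7 Prop. 7.1, §9] -/
theorem kottwitzSignAt_archPart_adele_eq (hH : (H.map (cmConjRingHom L))ᵀ = H) (hdet : H.det ≠ 0)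
    {a b : L} (hab : a ≠ b) (ha : a * cmConjRingHom L a = 1) (hb : b * cmConjRingHom L b = 1)
    (hγ₀ : ((((γ₀ : unitaryGroup (cmConjRingHom L) H).val : GL (Fin 3) L) : Matrix (Fin 3) (Fin 3) L) - a • (1 : Matrix (Fin 3) (Fin 3) L)) *
      ((((γ₀ : unitaryGroup (cmConjRingHom L) H).val : GL (Fin 3) L) : Matrix (Fin 3) (Fin 3) L) - b • (1 : Matrix (Fin 3) (Fin 3) L)) = 0)
    (hα : (((γ₀ : unitaryGroup (cmConjRingHom L) H).val : GL (Fin 3) L) : Matrix (Fin 3) (Fin 3) L) ≠ a • 1)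
    (hβ : (((γ₀ : unitaryGroup (cmConjRingHom L) H).val : GL (Fin 3) L) : Matrix (Fin 3) (Fin 3) L) ≠ b • 1)
    (q : MatchingAdeleG₂ L H H γ₀) {g : GL (Fin 3) (AdeleRing (𝓞 L) L)}
    (hg : g * (((UnitaryGroup.cmDatum L 3 H).toAdelic γ₀).val : GL (Fin 3) (AdeleRing (𝓞 L) L)) * g⁻¹ = (q.adele.val : GL (Fin 3) (AdeleRing (𝓞 L) L)))
    (W : (AdeleRing (𝓞 ↥(maximalRealSubfield L)) ↥(maximalRealSubfield L))ˣ)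
    (hW : ((AdeleRing.ideleBaseChange (↥(maximalRealSubfield L)) L W : (AdeleRing (𝓞 L) L)ˣ) : AdeleRing (𝓞 L) L) = adelicBlockDet γ₀ a b g)
    (w : {w : InfinitePlace L // IsComplex w}) :
    kottwitzSignAt L 3 H w (UnitaryGroup.archPart (↥(maximalRealSubfield L)) L (IsCMField.complexConj L) 3 H q.adele) =
      kottwitzSignAt L 3 H w (cmRationalToArch L 3 H γ₀) *
        (if ideleInfiniteComponent (↥(maximalRealSubfield L)) (w.1.comap (algebraMap (↥(maximalRealSubfield L)) L)) W ∈
            quadraticNormSubgroup ((w.1.comap (algebraMap (↥(maximalRealSubfield L)) L)).Completion)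
              (algebraMap (↥(maximalRealSubfield L)) _ (cmQuadraticGenerator L : ↥(maximalRealSubfield L)))
          then 1 else -1) := by
  have hHu : IsUnit H.det := isUnit_iff_ne_zero.mpr hdet
  have h2 : (1 : L) + 1 ≠ 0 := by norm_num
  obtain ⟨a', b', P, d, hab', -, -, hd, hd0, hP, hγP⟩ :=
    exists_diagonal_frame (cmConjRingHom L) (cmConjRingHom_cmConjRingHom₆ (L := L)) h2 H hH hdet
      (γ₀ : unitaryGroup (cmConjRingHom L) H) hab hγ₀ hα hβ
  rcases hab' with ⟨rfl, rfl⟩ | ⟨rfl, rfl⟩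
  · exact kottwitzSignAt_archPart_adele_eq_of_frame hH hdet hab hγ₀ hd hd0 hP hγP q hg W hW w
  · have hγ₀' : ((((γ₀ : unitaryGroup (cmConjRingHom L) H).val : GL (Fin 3) L) : Matrix (Fin 3) (Fin 3) L) - a' • (1 : Matrix (Fin 3) (Fin 3) L)) *
        ((((γ₀ : unitaryGroup (cmConjRingHom L) H).val : GL (Fin 3) L) : Matrix (Fin 3) (Fin 3) L) - b' • (1 : Matrix (Fin 3) (Fin 3) L)) = 0 :=
      mul_sub_swap_eq_zero hγ₀
    obtain ⟨W', hW'⟩ := exists_ideleBaseChange_eq_adelicBlockDet hH hHu hab.symm hb ha hγ₀' q hg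
    rw [kottwitzSignAt_archPart_adele_eq_of_frame hH hdet hab.symm hγ₀' hd hd0 hP hγP q hg W' hW' w]
    congr 1
    -- `χ_w(W') = χ_w(W)`: `ev_w(W ⊗ 1) · ev_w(W' ⊗ 1) = |ev_w(det g)|² > 0`
    set w₀ := w.1.comap (algebraMap (↥(maximalRealSubfield L)) L) with hw₀
    have hw₀r : w₀.IsReal := IsTotallyReal.isReal w₀
    set φ : AdeleRing (𝓞 L) L →+* ℂ :=
      (UnitaryGroup.evalC L w).comp ((InfiniteAdeleRing.ringEquiv_mixedSpace L).toRingHom.comp (UnitaryGroup.adeleFst L)) with hφdef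
    have hc1 : IsCMField.complexConj L ≠ 1 := IsCMField.complexConj_ne_one L
    have hφσ : ∀ x : AdeleRing (𝓞 L) L, φ (adeleConj L x) = starRingEnd ℂ (φ x) := fun x => by
      show UnitaryGroup.evalC L w (InfiniteAdeleRing.ringEquiv_mixedSpace L (UnitaryGroup.adeleFst L (adeleConj L x))) =
        starRingEnd ℂ (UnitaryGroup.evalC L w (InfiniteAdeleRing.ringEquiv_mixedSpace L (UnitaryGroup.adeleFst L x)))
      rw [show UnitaryGroup.adeleFst L (adeleConj L x) = (adeleConj L x).1 from rfl, show UnitaryGroup.adeleFst L x = x.1 from rfl,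
        QuadraticForms.ringEquiv_mixedSpace_fst_adeleConj, UnitaryGroup.evalC_conjMixed _ L _ (UnitaryGroup.complexConj_smul_infinitePlace L w.1) hc1]
    set E := InfinitePlace.Completion.ringEquivRealOfIsReal hw₀r with hE
    set tW : (w₀.Completion)ˣ := ideleInfiniteComponent (↥(maximalRealSubfield L)) w₀ W with htW
    set tW' : (w₀.Completion)ˣ := ideleInfiniteComponent (↥(maximalRealSubfield L)) w₀ W' with htW'
    have hprod : ((E (tW : w₀.Completion) * E (tW' : w₀.Completion) : ℝ) : ℂ) =
        ((Complex.normSq (φ (g : Matrix (Fin 3) (Fin 3) (AdeleRing (𝓞 L) L)).det) : ℝ) : ℂ) := by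
      rw [Complex.ofReal_mul, hE, htW, htW', ← evalC_ringEquiv_mixedSpace_ideleBaseChange w W, ← evalC_ringEquiv_mixedSpace_ideleBaseChange w W',
        ← hφdef, hW, hW', ← map_mul, adelicBlockDet_mul_adelicBlockDet_swap hHu hab hγ₀ q hg, map_mul, hφσ, ← Complex.normSq_eq_conj_mul_self]
    have hpos : 0 < E (tW : w₀.Completion) * E (tW' : w₀.Completion) := by
      have h := Complex.ofReal_injective hprod
      rw [h]
      exact Complex.normSq_pos.2 (((Matrix.isUnits_det_units g).map φ).ne_zero)
    have hρW0 : E (tW : w₀.Completion) ≠ 0 := fun h => by rw [h, zero_mul] at hpos; exact lt_irrefl _ hpos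
    have hρW'0 : E (tW' : w₀.Completion) ≠ 0 := fun h => by rw [h, mul_zero] at hpos; exact lt_irrefl _ hpos
    have hiff : 0 < E (tW' : w₀.Completion) ↔ 0 < E (tW : w₀.Completion) := ((mul_pos_iff_iff hρW0 hρW'0).1 hpos).symm
    rw [mem_quadraticNormSubgroup_completion_iff_pos hw₀r, mem_quadraticNormSubgroup_completion_iff_pos hw₀r]
    exact if_congr hiff rfl rfl

end ArchFlip

end Literature.NumberTheory.Rogawski1990

end
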